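/-
Copyright (c) 2026 the pub-hodgecm-mathlib formalisation cell (harness21).  Prover seat hodgecm-mathlib-LH4-p06 (g0): unit U2H_HSide of the «(D-RAM) FOUR-FRAME» road,
TIER-2 brick (c′) «CAYLEY ↔ `fPartProd` SIGN DICTIONARY» of dealer LH4-plan (g10) WORD #27 (A) (proposed socket `stub_U2H_cayleySign_fPartProd`).  2026-09-03.
-/
import Literature.NumberTheory.Rogawski1990.RamifiedPlaceNormSymbolDichotomy   -- ★ `hilbertSymbol_eq_one_iff_exists_norm_toPlace` (the norm reading of `(y, θ)_v`)
import Literature.NumberTheory.QuadraticForms.HilbertSymbolBilinear              -- ★ `hilbertSymbol_adicCompletion_mul_left` (every residue characteristic)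
import Literature.NumberTheory.LocalFields.QuadraticNormIndexFiniteCM            -- ★ `exists_fixed_norm_eq_of_valued_sub_one_lt_four` + (W-a) `exists_mul_self_eq_of_valued_sub_one_lt_four_adicCompletion`
import Literature.NumberTheory.Automorphic.UnitaryThreeFourFrameDefs             -- ★ #0a (p854559): `normSign`, `fPart`, `fPartProd`
import HarnessLib

/-!
# Crux `H413`, line LH4 «(D-RAM) FOUR-FRAME» road — unit U2H_HSide (ii-H), TIER 2, brick (c′): the CAYLEY ↔ `fPartProd` SIGN DICTIONARY
# `(b₀, θ)_v · (b₁, θ)_v = ω(x₃₁ · x₃₂) = normSign σ_w (fPartProd δ (a, b, 1) 2)` for deep norm-one `a, b`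

Cell `hodgecm-mathlib` (D-0151), FLOOR 0, crux item H413 = `stmt-HodgeConjecture-24833`, route of record `HCCMUnconditional`; squad F0∕P3c∕LH4; tier-1 module
`Cruxes/H413/Lines/F0_P3c_DyRamFourFrame_U2H_HSide.lean` (ED. 2), export `stub_U2H_hSideAnchorRows_unit0` (seat LH4-p06 (g0)); dealer WORD #27 (A) split proposal,
child (c′) `stub_U2H_cayleySign_fPartProd` («free-standing sign dictionary Cayley ↔ `fPartProd` for `Δ‴` near `1` wild-ramified over ★
`exists_finExplicitDelta_eq_of_cayley_ramified`»).  THEOREMS ONLY (no `def`, no instance, no notation, no `sorry`, no named fact, default heartbeats); lane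
`--supports stmt-HodgeConjecture-24833` (count-neutral).

THE MATHEMATICS (one non-split place `w ∣ v` of the CM extension `L ∕ L⁺`, `σ = σ_w`, `ι = ι_w : L⁺_v → L_w`, `θ` the CM generator, `(·, θ)_v` the local Hilbert symbol,
`ω(x) = normSign σ x = +1` iff `x ∈ N(L_w^×)`; ANY residue characteristic, ANY ramification).  Row (1) of (D-H) `HSideAnchorRows` multiplies the base transfer factor
`Δ‴_v[μ](γ_H, t_{b₀})` by the sheet's sign `baseSign i · ω(fPartProd δ (a, b, 1) i)`, where `l = (a, b, 1)` are the CANONICAL near-identity roots of the eigen-triple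
`(z a², z b², z)` of `γ_H` and `fPart δ l i j = (l_i² − l_j²)∕(l_i l_j δ)` (★ #0a H9∕H10).  ★ T5-b′ `FinExplicitTransferFactorDeepValueRamified` evaluates
`τ_v·D_{G∕H,v}` on deep type-(1) `γ_H` as `μ_v(u)·C_μ·(b₀, θ)_v (b₁, θ)_v·q^{−(N₀+N₁)∕2}` with CAYLEY PARAMETERS `ι b_i = (u_w∕d_{i,w} − 1)∕((u_w∕d_{i,w} + 1)·η)` for any
skew `η`; at `(u, d₀, d₁) = (z, z a², z b²)` and `η := δ` this is `ι b₀ = (a⁻² − 1)∕((a⁻² + 1)δ)`, `ι b₁ = (b⁻² − 1)∕((b⁻² + 1)δ)`.  THE DICTIONARY: since `σ a = a⁻¹`,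
  `ι b₀ · (a + σ a) = (1 − a²)∕(a δ) = fPart δ l 2 0`,   `ι b₁ · (b + σ b) = (1 − b²)∕(b δ) = fPart δ l 2 1`,
and `(a + σ a)∕2 = 1 − (a − 1)·σ(a − 1)∕2` is a `σ`-fixed unit with `|(a + σa)∕2 − 1|_w = |a − 1|_w²∕|2|_w < |4|_w` as soon as `|a − 1|_w² < |8|_w` — hence a NORM
(★ (W-b) «deep σ-fixed one-units are norms», from (W-a) «square roots near 1» in the complete field `L_w`; no parity hypothesis); so
`fPartProd δ l 2 = fPart δ l 2 0 · fPart δ l 2 1 = ι(b₀ b₁) · N(2 r₀ r₁)` and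
  **`(b₀, θ)_v · (b₁, θ)_v = (b₀ b₁, θ)_v = ω(ι(b₀ b₁)) = ω(fPartProd δ (a, b, 1) 2)`**
(★ bilinearity of the symbol at every finite place; ★ the norm reading `(y, θ)_v = 1 ↔ ι y ∈ N(L_w^×)`).  I.e. on the H-side row (1) at the U(1)-slot `i = 2` the two Hilbert
symbols of ★ T5-b′ CANCEL against the sheet's `normSign (fPartProd δ (a, b, 1) 2)` (their product is `ω(fPartProd)² = 1`), leaving `Δ‴·sign` DEPTH-ONLY — the consistency
of the law-shaped row (1) with a family of stable (depth-only) H-side orbital integrals.  The depth `|a − 1|_w² < |8|_w` is met by shrinking the row's `V ∈ 𝓝 1`.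

* §1 generic (`K` a field, `σ : K →+* K`): `normSign_mul_mul_map` (`ω(x · c σc) = ω(x)`, `c ≠ 0`), `cayley_mul_add_map_eq_fPart` (the identity `ι b₀·(a + σa) = fPart δ l 2 0`
  from the Cayley shape), `fPartProd_two` (`fPartProd δ l 2 = fPart δ l 2 0 · fPart δ l 2 1`).
* §2 at the place: `normSign_toPlace_eq_hilbertSymbol` (`ω(ι y) = (y, θ)_v`, `y ≠ 0`), `exists_fixed_two_mul_norm_eq_add_map` (`a σa = 1`, `|a − 1|² < |8|` ⇒
  `a + σ a = 2·r σr`, `σ r = r ≠ 0`), the HEAD **`hilbertSymbol_mul_hilbertSymbol_eq_normSign_fPartProd`**, and its reading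
  `…_of_eigen` in ★ T5-b′'s literal currency `u∕(u·a·a)` (`u = z ≠ 0`).
* §3 (ED. 2, append-only): `valued_eq_one_of_mul_map_eq_one`, `valued_mul_sub_one_mul_self_lt_of_deep` (products of deep norm-one elements are deep) and the
  germ-currency HEAD **`hilbertSymbol_symmDisc_eq_normSign_fPartProd`** — `(β, θ)_v = ω(fPartProd δ (a,b,1) 2)` for ★ T5-u-ANY-PLACE's symmetrised discriminant `β`
  (`exists_nhds_one_forall_finExplicitDelta_eq_hilbertSymbol_mul_anyPlace`), the form in which (D-H) row (1)'s `V ∈ 𝓝 1` comes for free.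

HONEST LABEL.  Count-neutral; nothing printed is asserted; the verdict of record for (D-RAM) stays PRINT [LanglandsShelstad1989 Thm. p. 484 ∕ Rogawski1990 Prop. 4.9.1 (a)]
∕ XL; `HC_CM` is proved only modulo the 7 printed citations (2 remaining: hLiu418 = `stmt-HodgeConjecture-24832`, h413 = `stmt-HodgeConjecture-24833`) until rung 0 closes.

## References
* [Rogawski1990] J. D. Rogawski, *Automorphic Representations of Unitary Groups in Three Variables*, Ann. of Math. Stud. 123 (1990): §4.9 p. 55 (`τ(γ) = μ(γ₂)μ⁻¹((γ₂γ₁⁻¹ − 1)(1 − γ₂γ₃⁻¹))`),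
  Lemma 4.9.3 (4.9.2) p. 56, Prop. 8.1.3 p. 116.
* [LabesseLanglands1979] J.-P. Labesse, R. P. Langlands, *L-indistinguishability for SL(2)*, Canad. J. Math. 31 (1979): §2 (2.1)–(2.2) (the Cayley parameter of the ramified torus).
* [Omeara1963] O. T. O'Meara, *Introduction to Quadratic Forms* (1963): §63B (63:10, 63:13a) (`(y, θ) = 1` iff `y` is a norm; multiplicativity).
* [Serre1979] J.-P. Serre, *Local Fields*, GTM 67 (1979): Ch. V §2 Prop. 3, Ch. XIV §3–§4 (deep one-units are norms; the local symbol).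
-/

set_option autoImplicit false

noncomputable section

namespace Summit.HodgeConjecture.HodgeConjecture.Cruxes.H413.F0P3cDyRamCayleySignFPartProd

open NumberField IsDedekindDomain
open Literature.NumberTheory.Automorphic Literature.NumberTheory.Automorphic.UnitaryGroup Literature.NumberTheory.GaloisRepresentations
open Literature.NumberTheory.QuadraticForms Literature.NumberTheory.LocalFields Literature.NumberTheory.Rogawski1990
open Literature.NumberTheory.Automorphic.UnitaryThreeFourFrame
open scoped Valued WithZero

/-! ## §1 Generic algebra: `ω(x · N c) = ω(x)`, the Cayley–`fPart` identity, `fPartProd` at slot `2` -/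

section Generic

variable {K : Type} [Field K] (σ : K →+* K)

/-- **`ω(x · c σc) = ω(x)`** for `c ≠ 0`: multiplying by a non-zero norm does not change the norm class (`x·cσc = zσz ↔ x = (z∕c)σ(z∕c)`).
[cite: Omeara1963, §63B (63:10)] -/
theorem normSign_mul_mul_map {x c : K} (hc : c ≠ 0) : normSign σ (x * (c * σ c)) = normSign σ x := by
  have hσc : σ c ≠ 0 := (map_ne_zero σ).2 hc
  have hiff : (∃ z : K, z * σ z = x * (c * σ c)) ↔ ∃ z : K, z * σ z = x := by
    constructor
    · rintro ⟨z, hz⟩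
      refine ⟨z / c, ?_⟩
      rw [map_div₀]
      field_simp
      linear_combination hz
    · rintro ⟨z, hz⟩
      exact ⟨z * c, by rw [map_mul, ← hz]; ring⟩
  unfold normSign
  by_cases h : ∃ z : K, z * σ z = x
  · rw [if_pos h, if_pos (hiff.2 h)]
  · rw [if_neg h, if_neg (fun h' => h (hiff.1 h'))]

omit σ in
/-- **`fPartProd δ l 2 = fPart δ l 2 0 · fPart δ l 2 1`** (slot `2`: the two roots through the U(1)-slot, ★ #0a H10). [cite: Rogawski1990, §4.9 p. 55] -/
theorem fPartProd_two (δ : K) (l : Fin 3 → K) : fPartProd δ l 2 = fPart δ l 2 0 * fPart δ l 2 1 := by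
  simp [fPartProd]

omit σ in
/-- **`fPart δ (a, b, 1) 2 0 = (1 − a·a)∕(a·δ)`** and **`fPart δ (a, b, 1) 2 1 = (1 − b·b)∕(b·δ)`** (★ #0a H9 unfolded at `l = (a, b, 1)`). [cite: Rogawski1990, §4.9 p. 55] -/
theorem fPart_two_eq (δ a b : K) :
    fPart δ ![a, b, 1] 2 0 = (1 - a * a) / (a * δ) ∧ fPart δ ![a, b, 1] 2 1 = (1 - b * b) / (b * δ) := by
  constructor <;> simp [fPart]

/-- **THE CAYLEY–`fPart` IDENTITY**: for `a` with `a · σ a = 1` and `x` of the Cayley shape `x = ((a·a)⁻¹ − 1)∕(((a·a)⁻¹ + 1)·δ)` with `x ≠ 0`: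
`x · (a + σ a) = (1 − a·a)∕(a·δ)` (`σ a = a⁻¹`; `x ≠ 0` forces `(a·a)⁻¹ + 1 ≠ 0` and `δ ≠ 0`). [cite: LabesseLanglands1979, §2 (2.2)] [cite: Rogawski1990, §4.9 p. 55] -/
theorem cayley_mul_add_map_eq_fPart {a δ x : K} (ha : a * σ a = 1) (hx : x = ((a * a)⁻¹ - 1) / (((a * a)⁻¹ + 1) * δ)) (hx0 : x ≠ 0) :
    x * (a + σ a) = (1 - a * a) / (a * δ) := by
  have ha0 : a ≠ 0 := fun h => by rw [h, zero_mul] at ha; exact zero_ne_one ha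
  have hσa : σ a = a⁻¹ := eq_inv_of_mul_eq_one_right ha
  have hden : ((a * a)⁻¹ + 1) * δ ≠ 0 := fun h => hx0 (by rw [hx, h, div_zero])
  have hδ0 : δ ≠ 0 := fun h => hden (by rw [h, mul_zero])
  have hp0 : (a * a)⁻¹ + 1 ≠ 0 := fun h => hden (by rw [h, zero_mul])
  have hp0' : 1 + a ^ 2 ≠ 0 := by
    intro h
    apply hp0
    have : (a * a)⁻¹ + 1 = (1 + a ^ 2) / (a * a) := by field_simp
    rw [this, h, zero_div]
  rw [hx, hσa]
  field_simp
  ring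

end Generic

/-! ## §2 At a non-split place of the CM extension: the norm reading of the symbol, deep one-units, and the HEAD -/

section Place

variable (L : Type) [Field L] [NumberField L] [IsCMField L] (v : HeightOneSpectrum (𝓞 ↥(maximalRealSubfield L)))
  (w : PlacesOver L v) (hw : IsCMField.complexConj L • w.1 = w.1)

/-- `θ = cmQuadraticGenerator L` is non-zero in `L⁺_v`. [folklore] -/
theorem algebraMap_cmQuadraticGenerator_ne_zero :
    (algebraMap ↥(maximalRealSubfield L) (v.adicCompletion ↥(maximalRealSubfield L)) ((cmQuadraticGenerator L : 𝓞 ↥(maximalRealSubfield L)) : ↥(maximalRealSubfield L))) ≠ 0 := by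
  rw [Ne, map_eq_zero_iff _ (algebraMap ↥(maximalRealSubfield L) (v.adicCompletion ↥(maximalRealSubfield L))).injective]
  exact fun h => not_isSquare_cmQuadraticGenerator L (by rw [h]; exact IsSquare.zero)

include hw in
/-- **`ω(ι_w y) = (y, θ)_v`** for `y ≠ 0` in `L⁺_v` at a non-split place: the sheet's norm-class sign `normSign σ_w` on the image of `L⁺_v` IS the local Hilbert symbol against the
CM generator (★ `hilbertSymbol_eq_one_iff_exists_norm_toPlace`; both take values `±1`). [cite: Omeara1963, §63B (63:10)] [cite: Serre1979, Ch. XIV §3] -/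
theorem normSign_toPlace_eq_hilbertSymbol {y : v.adicCompletion ↥(maximalRealSubfield L)} (hy : y ≠ 0) :
    normSign (galAdicCompletionMap (L := L) (IsCMField.complexConj L) hw) (toPlace v w y) =
      hilbertSymbol (v.adicCompletion ↥(maximalRealSubfield L)) y
        (algebraMap ↥(maximalRealSubfield L) _ ((cmQuadraticGenerator L : 𝓞 ↥(maximalRealSubfield L)) : ↥(maximalRealSubfield L))) := by
  have key := hilbertSymbol_eq_one_iff_exists_norm_toPlace L v w hw hy
  have hiff : (∃ z : w.1.adicCompletion L, z * galAdicCompletionMap (L := L) (IsCMField.complexConj L) hw z = toPlace v w y) ↔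
      ∃ z : w.1.adicCompletion L, galAdicCompletionMap (L := L) (IsCMField.complexConj L) hw z * z = toPlace v w y := by
    simp only [mul_comm]
  unfold normSign
  by_cases h : ∃ z : w.1.adicCompletion L, galAdicCompletionMap (L := L) (IsCMField.complexConj L) hw z * z = toPlace v w y
  · rw [if_pos (hiff.2 h), key.2 h]
  · rw [if_neg (fun h' => h (hiff.1 h'))]
    rcases hilbertSymbol_eq_one_or_eq_neg_one y
      (algebraMap ↥(maximalRealSubfield L) _ ((cmQuadraticGenerator L : 𝓞 ↥(maximalRealSubfield L)) : ↥(maximalRealSubfield L))) with h1 | h1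
    · exact absurd (key.1 h1) h
    · rw [h1]

include hw in
/-- **DEEP NORM-ONE ELEMENTS: `a + σ a` IS TWICE A NORM.**  If `a · σ_w a = 1` and `|a − 1|_w² < |8|_w` then `a + σ a = 2 · (r · σ r)` with `σ r = r ≠ 0`: indeed
`(a + σa)∕2 − 1 = −(a − 1)·σ(a − 1)∕2` has valuation `|a − 1|²∕|2| < |4|`, so the σ-fixed unit `(a + σa)∕2` is a norm by ★ (W-b) (deep σ-fixed one-units are norms, via square
roots near `1` in the complete field `L_w`).  Every residue characteristic. [cite: Serre1979, Ch. V §2 Prop. 3; Ch. XIV §4] -/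
theorem exists_fixed_two_mul_norm_eq_add_map {a : w.1.adicCompletion L}
    (ha : a * galAdicCompletionMap (L := L) (IsCMField.complexConj L) hw a = 1)
    (ha8 : Valued.v (a - 1) * Valued.v (a - 1) < Valued.v (8 : w.1.adicCompletion L)) :
    ∃ r : w.1.adicCompletion L, galAdicCompletionMap (L := L) (IsCMField.complexConj L) hw r = r ∧ r ≠ 0 ∧
      a + galAdicCompletionMap (L := L) (IsCMField.complexConj L) hw a = 2 * (r * galAdicCompletionMap (L := L) (IsCMField.complexConj L) hw r) := by
  set σ := galAdicCompletionMap (L := L) (IsCMField.complexConj L) hw with hσdef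
  have hσσ : ∀ x, σ (σ x) = x := fun x =>
    galAdicCompletionMap_galAdicCompletionMap_of_smul_eq (IsCMField.complexConj L) w (IsCMField.complexConj_ne_one L) hw x
  have hσv : ∀ x : w.1.adicCompletion L, Valued.v (σ x) = Valued.v x := fun x => valued_galAdicCompletionMap _ _ hw x
  -- `2 ≠ 0`, `8 = 2 · 4`
  have h20 : (2 : w.1.adicCompletion L) ≠ 0 := by
    rw [show (2 : w.1.adicCompletion L) = algebraMap L (w.1.adicCompletion L) 2 from (map_ofNat _ 2).symm]
    exact (map_ne_zero_iff _ (algebraMap L (w.1.adicCompletion L)).injective).2 two_ne_zero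
  have hv20 : Valued.v (2 : w.1.adicCompletion L) ≠ 0 := (Valuation.ne_zero_iff _).2 h20
  -- the σ-fixed candidate `s = (a + σ a) / 2`
  set s : w.1.adicCompletion L := (a + σ a) / 2 with hsdef
  have hσ2 : σ 2 = 2 := map_ofNat σ 2
  have hσs : σ s = s := by
    rw [hsdef, map_div₀, map_add, hσσ, hσ2, add_comm]
  have hs1 : s - 1 = -((a - 1) * σ (a - 1)) / 2 := by
    rw [hsdef, map_sub, map_one]
    field_simp
    linear_combination ha
  have hvs : Valued.v (2 : w.1.adicCompletion L) * Valued.v (s - 1) = Valued.v (a - 1) * Valued.v (a - 1) := by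
    rw [← map_mul, hs1, mul_div_cancel₀ _ h20, Valuation.map_neg, map_mul, hσv]
  have hs4 : Valued.v (s - 1) < Valued.v (4 : w.1.adicCompletion L) := by
    have h8 : Valued.v (8 : w.1.adicCompletion L) = Valued.v (2 : w.1.adicCompletion L) * Valued.v (4 : w.1.adicCompletion L) := by
      rw [← map_mul]; norm_num
    have hlt : Valued.v (2 : w.1.adicCompletion L) * Valued.v (s - 1) < Valued.v (2 : w.1.adicCompletion L) * Valued.v (4 : w.1.adicCompletion L) := by
      rw [hvs, ← h8]; exact ha8
    exact lt_of_mul_lt_mul_left' hlt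
  obtain ⟨r, hσr, hr⟩ := exists_fixed_norm_eq_of_valued_sub_one_lt_four σ hσv
    (fun t ht => exists_mul_self_eq_of_valued_sub_one_lt_four_adicCompletion L w.1 t ht) hσs hs4
  have hs0 : s ≠ 0 := by
    intro h0
    rw [h0, zero_sub, Valuation.map_neg, Valuation.map_one] at hs4
    have h2le : Valued.v (2 : w.1.adicCompletion L) ≤ 1 := by
      rw [show (2 : w.1.adicCompletion L) = 1 + 1 by norm_num]
      exact le_trans (Valuation.map_add _ _ _) (max_le (le_of_eq (Valuation.map_one _)) (le_of_eq (Valuation.map_one _)))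
    have h4le : Valued.v (4 : w.1.adicCompletion L) ≤ 1 := by
      rw [show (4 : w.1.adicCompletion L) = 2 * 2 by norm_num, map_mul]
      exact mul_le_one' h2le h2le
    exact (lt_irrefl _) (lt_of_lt_of_le hs4 h4le)
  have hr0 : r ≠ 0 := by
    intro h0; apply hs0; rw [← hr, h0, zero_mul]
  refine ⟨r, hσr, hr0, ?_⟩
  rw [hr, hsdef, mul_div_cancel₀ _ h20]

include hw in
/-- **HEAD (c′) — THE CAYLEY ↔ `fPartProd` SIGN DICTIONARY.**  At a non-split place `w ∣ v` of the CM extension `L ∕ L⁺`, `σ = σ_w`, for a skew-free datum: `a, b ∈ L_w` with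
`a·σa = b·σb = 1` and `|a − 1|_w², |b − 1|_w² < |8|_w` (deep norm-one — the canonical roots of a type-(1) element close enough to `1`), `δ ∈ L_w`, and `b₀, b₁ ∈ L⁺_v` non-zero
of the CAYLEY SHAPE `ι_w b₀ = ((a·a)⁻¹ − 1)∕(((a·a)⁻¹ + 1)·δ)`, `ι_w b₁ = ((b·b)⁻¹ − 1)∕(((b·b)⁻¹ + 1)·δ)` (★ T5-b′'s parameters at `(u, d₀, d₁, η) = (z, z a², z b², δ)`):
  `(b₀, θ)_v · (b₁, θ)_v = normSign σ_w (fPartProd δ (a, b, 1) 2)`.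
Proof: `fPartProd δ (a,b,1) 2 = fPart 2 0 · fPart 2 1 = ι b₀ (a + σa) · ι b₁ (b + σb) = ι(b₀ b₁) · N(2 r₀ r₁)` (§1 and `exists_fixed_two_mul_norm_eq_add_map`), so its norm class is that
of `ι(b₀ b₁)`, which is `(b₀ b₁, θ)_v = (b₀, θ)_v (b₁, θ)_v` (★ norm reading, ★ bilinearity).  No tameness, no parity hypothesis.
[cite: Rogawski1990, §4.9 p. 55; Lemma 4.9.3 (4.9.2) p. 56] [cite: LabesseLanglands1979, §2 (2.1)–(2.2)] [cite: Omeara1963, §63B (63:10, 63:13a)] -/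
theorem hilbertSymbol_mul_hilbertSymbol_eq_normSign_fPartProd {δ a b : w.1.adicCompletion L}
    (ha : a * galAdicCompletionMap (L := L) (IsCMField.complexConj L) hw a = 1) (hb : b * galAdicCompletionMap (L := L) (IsCMField.complexConj L) hw b = 1)
    (ha8 : Valued.v (a - 1) * Valued.v (a - 1) < Valued.v (8 : w.1.adicCompletion L))
    (hb8 : Valued.v (b - 1) * Valued.v (b - 1) < Valued.v (8 : w.1.adicCompletion L))
    {b₀ b₁ : v.adicCompletion ↥(maximalRealSubfield L)} (hb₀0 : b₀ ≠ 0) (hb₁0 : b₁ ≠ 0)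
    (hb₀ : toPlace v w b₀ = ((a * a)⁻¹ - 1) / (((a * a)⁻¹ + 1) * δ)) (hb₁ : toPlace v w b₁ = ((b * b)⁻¹ - 1) / (((b * b)⁻¹ + 1) * δ)) :
    hilbertSymbol (v.adicCompletion ↥(maximalRealSubfield L)) b₀
        (algebraMap ↥(maximalRealSubfield L) _ ((cmQuadraticGenerator L : 𝓞 ↥(maximalRealSubfield L)) : ↥(maximalRealSubfield L))) *
      hilbertSymbol (v.adicCompletion ↥(maximalRealSubfield L)) b₁
        (algebraMap ↥(maximalRealSubfield L) _ ((cmQuadraticGenerator L : 𝓞 ↥(maximalRealSubfield L)) : ↥(maximalRealSubfield L))) =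
      normSign (galAdicCompletionMap (L := L) (IsCMField.complexConj L) hw) (fPartProd δ ![a, b, 1] 2) := by
  set σ := galAdicCompletionMap (L := L) (IsCMField.complexConj L) hw with hσdef
  have hθ0 := algebraMap_cmQuadraticGenerator_ne_zero L v
  -- the two images are non-zero, so the Cayley shapes are non-degenerate
  have hx₀0 : toPlace v w b₀ ≠ 0 := (map_ne_zero_iff _ (toPlace v w).injective).2 hb₀0
  have hx₁0 : toPlace v w b₁ ≠ 0 := (map_ne_zero_iff _ (toPlace v w).injective).2 hb₁0
  -- `a + σa = 2 N(r₀)`, `b + σb = 2 N(r₁)`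
  obtain ⟨r₀, hσr₀, hr₀0, har₀⟩ := exists_fixed_two_mul_norm_eq_add_map L v w hw ha ha8
  obtain ⟨r₁, hσr₁, hr₁0, hbr₁⟩ := exists_fixed_two_mul_norm_eq_add_map L v w hw hb hb8
  have h20 : (2 : w.1.adicCompletion L) ≠ 0 := by
    rw [show (2 : w.1.adicCompletion L) = algebraMap L (w.1.adicCompletion L) 2 from (map_ofNat _ 2).symm]
    exact (map_ne_zero_iff _ (algebraMap L (w.1.adicCompletion L)).injective).2 two_ne_zero
  -- the Cayley–`fPart` identities
  have h₀ := cayley_mul_add_map_eq_fPart σ ha hb₀ hx₀0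
  have h₁ := cayley_mul_add_map_eq_fPart σ hb hb₁ hx₁0
  obtain ⟨hf0, hf1⟩ := fPart_two_eq δ a b
  -- `fPartProd = ι(b₀ b₁) · N(2 r₀ r₁)`
  have hc0 : (2 : w.1.adicCompletion L) * r₀ * r₁ ≠ 0 := mul_ne_zero (mul_ne_zero h20 hr₀0) hr₁0
  have hσ2 : σ 2 = 2 := map_ofNat σ 2
  have hprod : fPartProd δ ![a, b, 1] 2 = toPlace v w (b₀ * b₁) * ((2 * r₀ * r₁) * σ (2 * r₀ * r₁)) := by
    rw [fPartProd_two, hf0, hf1, ← h₀, ← h₁, har₀, hbr₁, map_mul, map_mul, map_mul, hσ2, hσr₀, hσr₁]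
    ring
  rw [hprod, normSign_mul_mul_map σ hc0, normSign_toPlace_eq_hilbertSymbol L v w hw (mul_ne_zero hb₀0 hb₁0),
    hilbertSymbol_adicCompletion_mul_left ↥(maximalRealSubfield L) v hb₀0 hb₁0 hθ0]

include hw in
/-- **HEAD (c′) IN ★ T5-b′'s LITERAL CURRENCY** (`u_w∕d_{i,w}` not yet simplified): the same dictionary with the Cayley shapes written as in ★
`exists_finExplicitDelta_eq_of_cayley_ramified` at `d₀ = u·(a·a)`, `d₁ = u·(b·b)` (`u = z = γ₂(γ_H)_w ≠ 0`, the U(1)-coordinate; `a, b` the canonical roots), i.e.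
`ι_w b₀ = (u∕(u·a·a) − 1)∕((u∕(u·a·a) + 1)·δ)` etc.: `(b₀, θ)_v · (b₁, θ)_v = normSign σ_w (fPartProd δ (a, b, 1) 2)`.
[cite: Rogawski1990, §4.9 p. 55; Lemma 4.9.3 (4.9.2) p. 56] [cite: LabesseLanglands1979, §2 (2.1)–(2.2)] -/
theorem hilbertSymbol_mul_hilbertSymbol_eq_normSign_fPartProd_of_eigen {δ a b u : w.1.adicCompletion L} (hu : u ≠ 0)
    (ha : a * galAdicCompletionMap (L := L) (IsCMField.complexConj L) hw a = 1) (hb : b * galAdicCompletionMap (L := L) (IsCMField.complexConj L) hw b = 1)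
    (ha8 : Valued.v (a - 1) * Valued.v (a - 1) < Valued.v (8 : w.1.adicCompletion L))
    (hb8 : Valued.v (b - 1) * Valued.v (b - 1) < Valued.v (8 : w.1.adicCompletion L))
    {b₀ b₁ : v.adicCompletion ↥(maximalRealSubfield L)} (hb₀0 : b₀ ≠ 0) (hb₁0 : b₁ ≠ 0)
    (hb₀ : toPlace v w b₀ = (u / (u * (a * a)) - 1) / ((u / (u * (a * a)) + 1) * δ))
    (hb₁ : toPlace v w b₁ = (u / (u * (b * b)) - 1) / ((u / (u * (b * b)) + 1) * δ)) :
    hilbertSymbol (v.adicCompletion ↥(maximalRealSubfield L)) b₀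
        (algebraMap ↥(maximalRealSubfield L) _ ((cmQuadraticGenerator L : 𝓞 ↥(maximalRealSubfield L)) : ↥(maximalRealSubfield L))) *
      hilbertSymbol (v.adicCompletion ↥(maximalRealSubfield L)) b₁
        (algebraMap ↥(maximalRealSubfield L) _ ((cmQuadraticGenerator L : 𝓞 ↥(maximalRealSubfield L)) : ↥(maximalRealSubfield L))) =
      normSign (galAdicCompletionMap (L := L) (IsCMField.complexConj L) hw) (fPartProd δ ![a, b, 1] 2) := by
  have hua : u / (u * (a * a)) = (a * a)⁻¹ := by rw [div_mul_eq_div_div, div_self hu, one_div]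
  have hub : u / (u * (b * b)) = (b * b)⁻¹ := by rw [div_mul_eq_div_div, div_self hu, one_div]
  rw [hua] at hb₀
  rw [hub] at hb₁
  exact hilbertSymbol_mul_hilbertSymbol_eq_normSign_fPartProd L v w hw ha hb ha8 hb8 hb₀0 hb₁0 hb₀ hb₁

end Place

/-! ## §3 (ED. 2, APPEND-ONLY) The SYMMETRISED-DISCRIMINANT currency of ★ T5-u-ANY-PLACE: `(β, θ)_v = ω(fPartProd δ (a, b, 1) 2)`

★ `FinExplicitTransferFactorDeepTauAnyPlacePairs.exists_nhds_one_forall_finExplicitDelta_eq_hilbertSymbol_mul_anyPlace` (the GERM form `∃ V ∈ 𝓝 1, ∀ γ_H ∈ V, …`, every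
non-split place, dyadic included) reads `Δ‴_v(γ_H, γ′) = (β, θ)_v · q_v^{−m} · κ_v(γ_H, γ′)` for ANY unit `β ∈ L⁺_v` with
`ι_w β = −χ_g(u)_w · (u_w² + det g_w) ∕ (2 · u_w² · det g_w)` (the `σ_w`-fixed symmetrisation of `−χ_g(u)∕det g`).  For a type-(1) `γ_H` with eigen-triple `(z a², z b², z)`:
`u_w = z`, `χ_g(u)_w = (z − z a²)(z − z b²)`, `det g_w = z²·a²·b²`, so `ι_w β = −(1 − a²)(1 − b²)(1 + a²b²) ∕ (2 a² b²)`; and with `c := a b` (norm-one, deep)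
`1 + c² = c·(c + σ c) = 2 c · N(r)` (§2 `exists_fixed_two_mul_norm_eq_add_map`), whence `ι_w β = −(1 − a²)(1 − b²)·N(r) ∕ (a b) = fPartProd δ (a,b,1) 2 · N(δ r)`
(`δ` skew: `δ·σδ = −δ²`).  Hence **`(β, θ)_v = ω(ι_w β) = ω(fPartProd δ (a, b, 1) 2)`** — the germ-form sibling of the §2 HEAD, the currency in which (D-H) row (1)'s
`V ∈ 𝓝 1` is supplied by ★ for free (no Cayley parameters, no `d₀, d₁`, no `M₀`). -/

section SymmDisc

variable (L : Type) [Field L] [NumberField L] [IsCMField L] (v : HeightOneSpectrum (𝓞 ↥(maximalRealSubfield L)))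
  (w : PlacesOver L v) (hw : IsCMField.complexConj L • w.1 = w.1)

include hw in
/-- A norm-one `a` (`a·σ_w a = 1`) has `|a|_w = 1` (`σ_w` preserves `|·|_w`). [cite: Serre1979, Ch. V §3] -/
theorem valued_eq_one_of_mul_map_eq_one {a : w.1.adicCompletion L} (ha : a * galAdicCompletionMap (L := L) (IsCMField.complexConj L) hw a = 1) :
    Valued.v a = 1 := by
  have h : Valued.v a * Valued.v a = 1 := by
    have := congrArg Valued.v ha
    rwa [map_mul, valued_galAdicCompletionMap, map_one] at this
  rcases lt_trichotomy (Valued.v a) 1 with hlt | heq | hgt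
  · exact absurd h (mul_lt_one_of_nonneg_of_lt_one_left zero_le hlt hlt.le).ne
  · exact heq
  · exact absurd h (lt_of_lt_of_le hgt (le_mul_of_one_le_right' hgt.le)).ne'

include hw in
/-- **The product of two deep norm-one elements is deep**: `|a b − 1|_w² < |8|_w` from `|a − 1|_w², |b − 1|_w² < |8|_w` (`a b − 1 = a(b − 1) + (a − 1)`, `|a|_w = 1`).
[cite: Serre1979, Ch. V §3] -/
theorem valued_mul_sub_one_mul_self_lt_of_deep {a b : w.1.adicCompletion L}
    (ha : a * galAdicCompletionMap (L := L) (IsCMField.complexConj L) hw a = 1)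
    (ha8 : Valued.v (a - 1) * Valued.v (a - 1) < Valued.v (8 : w.1.adicCompletion L))
    (hb8 : Valued.v (b - 1) * Valued.v (b - 1) < Valued.v (8 : w.1.adicCompletion L)) :
    Valued.v (a * b - 1) * Valued.v (a * b - 1) < Valued.v (8 : w.1.adicCompletion L) := by
  have hva : Valued.v a = 1 := valued_eq_one_of_mul_map_eq_one L v w hw ha
  have hsplit : a * b - 1 = a * (b - 1) + (a - 1) := by ring
  have hle : Valued.v (a * b - 1) ≤ max (Valued.v (b - 1)) (Valued.v (a - 1)) := by
    rw [hsplit]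
    refine le_trans (Valuation.map_add _ _ _) ?_
    rw [map_mul, hva, one_mul]
  rcases le_max_iff.1 hle with h | h
  · exact lt_of_le_of_lt (mul_le_mul' h h) hb8
  · exact lt_of_le_of_lt (mul_le_mul' h h) ha8

include hw in
/-- **HEAD (c″) — THE SYMMETRISED-DISCRIMINANT ↔ `fPartProd` SIGN DICTIONARY.**  At a non-split place `w ∣ v`, `σ = σ_w`, for `δ` skew non-zero, `u ≠ 0`, deep norm-one `a, b`
(`a·σa = b·σb = 1`, `|a − 1|², |b − 1|² < |8|`) and `β ∈ L⁺_v` non-zero with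
`ι_w β = −((u − u·a·a)(u − u·b·b) · (u² + u²·(a·a)(b·b))) ∕ (2 · u² · (u²·(a·a)(b·b)))` — ★ T5-u-ANY-PLACE's symmetrised discriminant at
`(χ_g(u)_w, det g_w) = ((u − u a²)(u − u b²), u² a² b²)`, i.e. at the eigen-triple `(u a², u b², u)` —: `(β, θ)_v = normSign σ_w (fPartProd δ (a, b, 1) 2)`.
[cite: Rogawski1990, §4.9 p. 55; Lemma 4.9.3 (4.9.2) p. 56; Prop. 8.1.3 p. 116] [cite: LabesseLanglands1979, §2 (2.1)–(2.2)] [cite: Omeara1963, §63B (63:10)] -/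
theorem hilbertSymbol_symmDisc_eq_normSign_fPartProd {δ a b u : w.1.adicCompletion L}
    (hδ : galAdicCompletionMap (L := L) (IsCMField.complexConj L) hw δ = -δ) (hδ0 : δ ≠ 0) (hu : u ≠ 0)
    (ha : a * galAdicCompletionMap (L := L) (IsCMField.complexConj L) hw a = 1) (hb : b * galAdicCompletionMap (L := L) (IsCMField.complexConj L) hw b = 1)
    (ha8 : Valued.v (a - 1) * Valued.v (a - 1) < Valued.v (8 : w.1.adicCompletion L))
    (hb8 : Valued.v (b - 1) * Valued.v (b - 1) < Valued.v (8 : w.1.adicCompletion L))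
    {β : v.adicCompletion ↥(maximalRealSubfield L)} (hβ0 : β ≠ 0)
    (hβ : toPlace v w β = -(((u - u * (a * a)) * (u - u * (b * b))) * (u ^ 2 + u ^ 2 * ((a * a) * (b * b)))) / (2 * u ^ 2 * (u ^ 2 * ((a * a) * (b * b))))) :
    hilbertSymbol (v.adicCompletion ↥(maximalRealSubfield L)) β
        (algebraMap ↥(maximalRealSubfield L) _ ((cmQuadraticGenerator L : 𝓞 ↥(maximalRealSubfield L)) : ↥(maximalRealSubfield L))) =
      normSign (galAdicCompletionMap (L := L) (IsCMField.complexConj L) hw) (fPartProd δ ![a, b, 1] 2) := by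
  set σ := galAdicCompletionMap (L := L) (IsCMField.complexConj L) hw with hσdef
  have ha0 : a ≠ 0 := fun h => by rw [h, zero_mul] at ha; exact zero_ne_one ha
  have hb0 : b ≠ 0 := fun h => by rw [h, zero_mul] at hb; exact zero_ne_one hb
  have h20 : (2 : w.1.adicCompletion L) ≠ 0 := by
    rw [show (2 : w.1.adicCompletion L) = algebraMap L (w.1.adicCompletion L) 2 from (map_ofNat _ 2).symm]
    exact (map_ne_zero_iff _ (algebraMap L (w.1.adicCompletion L)).injective).2 two_ne_zero
  -- `c = a b` is norm-one and deep, so `c + σ c = 2 N(r)`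
  have hc : a * b * σ (a * b) = 1 := by
    rw [map_mul]; linear_combination (b * σ b) * ha + hb
  have hc8 := valued_mul_sub_one_mul_self_lt_of_deep L v w hw ha ha8 hb8
  obtain ⟨r, hσr, hr0, hcr⟩ := exists_fixed_two_mul_norm_eq_add_map L v w hw hc hc8
  have hσc : σ (a * b) = (a * b)⁻¹ := eq_inv_of_mul_eq_one_right hc
  -- `1 + (ab)² = 2·(ab)·N(r)`
  have hkey : 1 + (a * b) * (a * b) = 2 * (a * b) * (r * r) := by
    have h1 : a * b + (a * b)⁻¹ = 2 * (r * σ r) := by rw [← hσc]; exact hcr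
    rw [hσr] at h1
    have hab0 : a * b ≠ 0 := mul_ne_zero ha0 hb0
    field_simp at h1
    linear_combination h1
  -- the image of `β` is `fPartProd · N(δ r)`
  have hσδr : σ (δ * r) = -δ * r := by rw [map_mul, hδ, hσr]
  have hnum : u ^ 2 + u ^ 2 * ((a * a) * (b * b)) = u ^ 2 * (2 * (a * b) * (r * r)) := by rw [← hkey]; ring
  have hprod : toPlace v w β = fPartProd δ ![a, b, 1] 2 * ((δ * r) * σ (δ * r)) := by
    rw [hβ, hnum, hσδr, fPartProd_two, (fPart_two_eq δ a b).1, (fPart_two_eq δ a b).2]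
    field_simp
  rw [← normSign_toPlace_eq_hilbertSymbol L v w hw hβ0, hprod, normSign_mul_mul_map σ (mul_ne_zero hδ0 hr0)]

end SymmDisc

end Summit.HodgeConjecture.HodgeConjecture.Cruxes.H413.F0P3cDyRamCayleySignFPartProd

end
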